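import Literature.Probability.LatticeModels.StarCrossing
import HarnessLib

/-!
# Site-percolation duality for rectangle crossings of `ℤ²` (`+` lattice paths versus `-∗` paths)

Topic `Probability/Percolation`. The matching-pair duality of site percolation on the square
lattice (Kesten 1982, §2.2 and Prop. 2.2; Russo 1978; used throughout Georgii–Higuchi 2000, e.g.
proof of Lemma 2.1: "either … `+`path … or … `-∗`circuit"): for every two-colouring of the sites
of the rectangle `R = [0, m] × [0, n]` (`m ≥ 1`), **exactly one** of

* there is a lattice path of `+`sites inside `R` from the left side to the right side,
* there is a `∗`-path of `-`sites inside `R` from the top side to the bottom side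

holds. "Not both" is the crossing lemma `exists_mem_support_of_crossing_star` (`StarCrossing`).
"At least one" is **derived from the bond duality of the tree**
(`lrCrossing_xor_dualTBCrossing_holds`, `PlanarDuality`): declare a lattice edge open when both
endpoints are `+` (sites outside `R` counting as `+`); an open left-right bond crossing is a
`+`site crossing, and a dual-open top-bottom crossing of the dual rectangle yields, edge by edge,
a `-` endpoint of each crossed primal edge; consecutive such endpoints are corners of a common
face, hence equal or `∗`-adjacent, and the first and last lie on the top and bottom rows.

* `plusLRCrossing_or_minusStarTBCrossing`, `not_plusLRCrossing_and_minusStarTBCrossing`,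
  `plusLRCrossing_xor_minusStarTBCrossing`.

## References

* H. Kesten, *Percolation theory for mathematicians*, Birkhäuser 1982, §2.2, Prop. 2.2 [Kesten1982].
* H.-O. Georgii, Y. Higuchi, J. Math. Phys. 41 (2000), §2 (matching-pair duality of `+` and `-∗`
  paths) [GeorgiiHiguchi2000].
* B. Bollobás, O. Riordan, *Percolation*, CUP 2006, Ch. 3, Lemma 1 [BollobasRiordan2006].
-/

noncomputable section

open SimpleGraph
open Literature.Probability.LatticeModels (Site zdGraph zdStarGraph zdGraph_adj_iff zdStarGraph_adj
  zdGraph_le_zdStarGraph exists_mem_support_of_crossing_star)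

namespace Literature.Probability.Percolation

variable {c : Site 2 → Prop} {m n : ℕ}

/-! ### The bond configuration of a colouring -/

/-- Sites outside the rectangle count as coloured. [folklore] -/
def extColour (c : Site 2 → Prop) (m n : ℕ) (x : Site 2) : Prop := c x ∨ x ∉ rectangle m n

/-- The bond configuration of a colouring: a lattice edge is open iff both endpoints are coloured
(or outside the rectangle). [cite: Kesten1982, §2.2] -/
def colourConfig (c : Site 2 → Prop) (m n : ℕ) : BondConfig (Site 2) :=
  {e | e ∈ (zdGraph 2).edgeSet ∧ ∀ x ∈ e, extColour c m n x}

/-- The colour configuration is a lattice configuration. [folklore] -/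
theorem colourConfig_subset_edgeSet : colourConfig c m n ⊆ (zdGraph 2).edgeSet := fun _ h => h.1

/-- The endpoints of the separating edge of two adjacent faces are corners of both faces. [folklore] -/
theorem corner_of_mem_sepEdge {z z' w : Site 2} (h : (zdGraph 2).Adj z z') (hw : w ∈ sepEdge z z') :
    ∀ i, z i ≤ w i ∧ w i ≤ z i + 1 := by
  have key : ∀ {a b v : Site 2}, StepKind a b → v ∈ sepEdge a b → ∀ i, a i ≤ v i ∧ v i ≤ a i + 1 := by
    intro a b v hab hv
    rcases hab with ⟨h0, h1⟩ | ⟨h0, h1⟩ | ⟨h1, h0⟩ | ⟨h1, h0⟩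
    · obtain rfl : b = a + Pi.single 0 1 := by simp [Site.eq_iff_two, h0, h1]
      rw [sepEdge_right, Sym2.mem_iff] at hv
      intro i; fin_cases i <;> rcases hv with rfl | rfl <;> simp
    · obtain rfl : a = b + Pi.single 0 1 := by simp [Site.eq_iff_two, h0, h1]
      rw [sepEdge_comm, sepEdge_right, Sym2.mem_iff] at hv
      intro i; fin_cases i <;> rcases hv with rfl | rfl <;> simp
    · obtain rfl : b = a + Pi.single 1 1 := by simp [Site.eq_iff_two, h0, h1]
      rw [sepEdge_up, Sym2.mem_iff] at hv
      intro i; fin_cases i <;> rcases hv with rfl | rfl <;> simp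
    · obtain rfl : a = b + Pi.single 1 1 := by simp [Site.eq_iff_two, h0, h1]
      rw [sepEdge_comm, sepEdge_up, Sym2.mem_iff] at hv
      intro i; fin_cases i <;> rcases hv with rfl | rfl <;> simp
  exact key (stepKind_of_adj h) hw

/-- Corners of a common face are equal or `∗`-adjacent. [folklore] -/
theorem eq_or_zdStarGraph_adj_of_corner {z v w : Site 2} (hv : ∀ i, z i ≤ v i ∧ v i ≤ z i + 1)
    (hw : ∀ i, z i ≤ w i ∧ w i ≤ z i + 1) : v = w ∨ zdStarGraph.Adj v w := by
  by_cases h : v = w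
  · exact Or.inl h
  · refine Or.inr ⟨h, fun i => ?_⟩
    have h1 := hv i; have h2 := hw i
    rw [abs_le]; constructor <;> linarith

/-- All vertices of a walk in the open subgraph on `O` starting in `O` lie in `O`. [folklore] -/
theorem support_subset_of_siteOpenGraph_walk {V : Type*} {G : SimpleGraph V} {O : Set V} :
    ∀ {u v : V} (p : (siteOpenGraph G O).Walk u v), u ∈ O → ∀ z ∈ p.support, z ∈ O
  | _, _, Walk.nil, hu, z, hz => by
    rw [Walk.support_nil, List.mem_singleton] at hz; exact hz ▸ hu
  | _, _, Walk.cons hadj p', _, z, hz => by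
    rw [Walk.support_cons, List.mem_cons] at hz
    rcases hz with rfl | hz
    · exact ((siteOpenGraph_adj _ _ _ _).1 hadj).2.1
    · exact support_subset_of_siteOpenGraph_walk p' ((siteOpenGraph_adj _ _ _ _).1 hadj).2.2 z hz

/-! ### At least one -/

/-- **An open bond crossing of the colour configuration is a `+` site crossing** (`m ≥ 1`). [cite: Kesten1982, §2.2] -/
theorem plusLRCrossing_of_lrCrossing (hm : 1 ≤ m) (h : colourConfig c m n ∈ lrCrossing m n) :
    (∃ x ∈ leftSide m n, ∃ y ∈ rightSide m n, ∃ p : (zdGraph 2).Walk x y, ∀ z ∈ p.support, z ∈ rectangle m n ∧ c z) := by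
  obtain ⟨x, hx, y, hy, hxy⟩ := h
  obtain ⟨P, hPS, hPω⟩ := exists_walk_of_mem_openConnIn colourConfig_subset_edgeSet hxy
  refine ⟨x, hx, y, hy, P, fun z hz => ⟨hPS z hz, ?_⟩⟩
  -- `P` has at least one edge since the two sides are distinct columns
  have hne : x ≠ y := by
    intro hxy'
    have h1 := (Finset.mem_filter.1 (Finset.mem_coe.1 hx)).2
    have h2 := (Finset.mem_filter.1 (Finset.mem_coe.1 hy)).2
    rw [hxy'] at h1; rw [h1] at h2
    have : (m : ℤ) = 0 := h2.symm
    omega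
  -- every vertex of a walk with an edge is an endpoint of one of its edges
  obtain ⟨e, he, hze⟩ : ∃ e ∈ P.edges, z ∈ e := by
    have key : ∀ {u w : Site 2} (W : (zdGraph 2).Walk u w), 0 < W.length → ∀ z ∈ W.support, ∃ e ∈ W.edges, z ∈ e := by
      intro u w W
      induction W with
      | nil => intro h; simp at h
      | @cons u₁ u₂ u₃ hadj W' ih =>
        intro _ z hz
        rw [Walk.support_cons, List.mem_cons] at hz
        rcases hz with rfl | hz
        · exact ⟨s(z, u₂), by simp [Walk.edges_cons], Sym2.mem_mk_left _ _⟩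
        · cases W' with
          | nil =>
            rw [Walk.support_nil, List.mem_singleton] at hz
            subst hz
            exact ⟨s(u₁, z), by simp [Walk.edges_cons], Sym2.mem_mk_right _ _⟩
          | cons h' W'' =>
            obtain ⟨e, he, hze⟩ := ih (by simp) z hz
            exact ⟨e, by rw [Walk.edges_cons]; exact List.mem_cons_of_mem _ he, hze⟩
    have hlen : 0 < P.length := by
      cases P with
      | nil => exact absurd rfl hne
      | cons _ _ => simp
    exact key P hlen z hz
  have hopen := hPω e he
  rcases hopen.2 z hze with hc | hout
  · exact hc
  · exact absurd (hPS z hz) hout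

/-- **A dual-open crossing of the colour configuration yields a `-∗` site crossing.** [cite: Kesten1982, §2.2] -/
theorem minusStarTBCrossing_of_dualTBCrossing (h : colourConfig c m n ∈ dualTBCrossing m n) :
    (∃ x ∈ topSide m n, ∃ y ∈ bottomSide m n, ∃ q : zdStarGraph.Walk x y, ∀ z ∈ q.support, z ∈ rectangle m n ∧ ¬ c z) := by
  obtain ⟨t, ht, s, hs, hts⟩ := (mem_openCrossing_iff.1 h :)
  obtain ⟨Q, hQS, hQω⟩ := exists_walk_of_mem_openConnIn
    (fun _ h => h.1 : dualConfig (colourConfig c m n) ⊆ (zdGraph 2).edgeSet) hts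
  have ht' := (Finset.mem_filter.1 (Finset.mem_coe.1 ht)).2
  have hs' := (Finset.mem_filter.1 (Finset.mem_coe.1 hs)).2
  -- a `-` endpoint of the primal edge crossed by each dual step
  have hbad : ∀ dq ∈ Q.darts, ∃ v ∈ sepEdge dq.fst dq.snd, v ∈ rectangle m n ∧ ¬ c v := by
    intro dq hdq
    have hdual : s(dq.fst, dq.snd) ∈ dualConfig (colourConfig c m n) :=
      hQω _ (by rw [Walk.edges]; exact List.mem_map.2 ⟨dq, hdq, rfl⟩)
    have hprim : sepEdge dq.fst dq.snd ∉ colourConfig c m n := fun hmem =>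
      (mem_dualConfig_iff.1 hdual).2 _ hmem (dualEdge_sepEdge dq.adj)
    simp only [colourConfig, Set.mem_setOf_eq, not_and, not_forall] at hprim
    obtain ⟨v, hv, hv'⟩ := hprim (sepEdge_mem_edgeSet dq.adj)
    simp only [extColour, not_or, not_not] at hv'
    exact ⟨v, hv, hv'.2, hv'.1⟩
  -- the bad sites and their `∗`-graph
  set BAD : Set (Site 2) := {z | z ∈ rectangle m n ∧ ¬ c z} with hBAD
  -- induction along the face walk: from a bad corner of the first face to a bad corner of the last
  have build : ∀ {a b : Site 2} (W : (zdGraph 2).Walk a b),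
      (∀ dq ∈ W.darts, ∃ v ∈ sepEdge dq.fst dq.snd, v ∈ rectangle m n ∧ ¬ c v) →
      ∀ v₀ : Site 2, (∀ i, a i ≤ v₀ i ∧ v₀ i ≤ a i + 1) → v₀ ∈ BAD →
        ∃ w : Site 2, (∀ i, b i ≤ w i ∧ w i ≤ b i + 1) ∧ w ∈ BAD ∧
          (siteOpenGraph zdStarGraph BAD).Reachable v₀ w := by
    intro a b W
    induction W with
    | nil => exact fun _ v₀ hv₀ hv₀B => ⟨v₀, hv₀, hv₀B, Reachable.refl _⟩
    | @cons a₁ a₂ a₃ hadj W' ih =>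
      intro hW v₀ hv₀ hv₀B
      obtain ⟨v₁, hv₁e, hv₁R, hv₁c⟩ := hW ⟨⟨a₁, a₂⟩, hadj⟩ (by simp [Walk.darts_cons])
      have hv₁a₁ : ∀ i, a₁ i ≤ v₁ i ∧ v₁ i ≤ a₁ i + 1 := corner_of_mem_sepEdge hadj hv₁e
      have hv₁a₂ : ∀ i, a₂ i ≤ v₁ i ∧ v₁ i ≤ a₂ i + 1 :=
        corner_of_mem_sepEdge hadj.symm (by rw [sepEdge_comm]; exact hv₁e)
      obtain ⟨w, hw, hwB, hr⟩ := ih (fun dq hdq => hW dq (by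
        rw [Walk.darts_cons]; exact List.mem_cons_of_mem _ hdq)) v₁ hv₁a₂ ⟨hv₁R, hv₁c⟩
      refine ⟨w, hw, hwB, Reachable.trans ?_ hr⟩
      rcases eq_or_zdStarGraph_adj_of_corner hv₀ hv₁a₁ with h | h
      · exact h ▸ Reachable.refl _
      · exact Adj.reachable ((siteOpenGraph_adj _ _ _ _).2 ⟨h, hv₀B, hv₁R, hv₁c⟩)
  -- the first dart gives a bad corner of the first face
  have hQne : 0 < Q.length := by
    cases Q with
    | nil => exfalso; rw [ht'] at hs'; have : (n : ℤ) = -1 := hs'; omega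
    | cons _ _ => simp
  -- a bad corner of `t` from the first dart of `Q`
  obtain ⟨v₀, hv₀t, hv₀B⟩ : ∃ v₀ : Site 2, (∀ i, t i ≤ v₀ i ∧ v₀ i ≤ t i + 1) ∧ v₀ ∈ BAD := by
    cases Q with
    | nil => simp at hQne
    | cons h W' =>
      obtain ⟨v, hve, hvR, hvc⟩ := hbad ⟨⟨_, _⟩, h⟩ (by simp [Walk.darts_cons])
      exact ⟨v, corner_of_mem_sepEdge h hve, hvR, hvc⟩
  obtain ⟨w, hw, hwB, hr⟩ := build Q hbad v₀ hv₀t hv₀B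
  -- `v₀` is on the top row, `w` on the bottom row
  have hv₀top : v₀ ∈ topSide m n := by
    refine Finset.mem_filter.2 ⟨hv₀B.1, ?_⟩
    have h1 := hv₀t 1
    have h2 := (mem_rectangle_iff.1 hv₀B.1).2.2.2
    rw [ht'] at h1; omega
  have hwbot : w ∈ bottomSide m n := by
    refine Finset.mem_filter.2 ⟨hwB.1, ?_⟩
    have h1 := hw 1
    have h2 := (mem_rectangle_iff.1 hwB.1).2.2.1
    rw [hs'] at h1; omega
  obtain ⟨q⟩ := hr
  refine ⟨v₀, hv₀top, w, hwbot, q.mapLe (fun a b hab => ((siteOpenGraph_adj _ _ _ _).1 hab).1), fun z hz => ?_⟩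
  rw [Walk.support_mapLe_eq_support] at hz
  exact support_subset_of_siteOpenGraph_walk q hv₀B z hz

/-- **At least one**: a `+` left-right site crossing or a `-∗` top-bottom site crossing
(`m ≥ 1`). [cite: Kesten1982, Prop. 2.2] -/
theorem plusLRCrossing_or_minusStarTBCrossing (c : Site 2 → Prop) (hm : 1 ≤ m) (n : ℕ) :
    (∃ x ∈ leftSide m n, ∃ y ∈ rightSide m n, ∃ p : (zdGraph 2).Walk x y, ∀ z ∈ p.support, z ∈ rectangle m n ∧ c z) ∨
      (∃ x ∈ topSide m n, ∃ y ∈ bottomSide m n, ∃ q : zdStarGraph.Walk x y, ∀ z ∈ q.support, z ∈ rectangle m n ∧ ¬ c z) := by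
  rcases lrCrossing_xor_dualTBCrossing_holds m n (colourConfig_subset_edgeSet (c := c)) with h | h
  · exact Or.inl (plusLRCrossing_of_lrCrossing hm h.1)
  · exact Or.inr (minusStarTBCrossing_of_dualTBCrossing h.1)

/-! ### Not both -/

/-- **Not both**: a `+` left-right site crossing and a `-∗` top-bottom site crossing of the same
rectangle would meet (`exists_mem_support_of_crossing_star`). [cite: Kesten1982, Prop. 2.2] -/
theorem not_plusLRCrossing_and_minusStarTBCrossing (c : Site 2 → Prop) (m n : ℕ) :
    ¬ ((∃ x ∈ leftSide m n, ∃ y ∈ rightSide m n, ∃ p : (zdGraph 2).Walk x y, ∀ z ∈ p.support, z ∈ rectangle m n ∧ c z) ∧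
      (∃ x ∈ topSide m n, ∃ y ∈ bottomSide m n, ∃ q : zdStarGraph.Walk x y, ∀ z ∈ q.support, z ∈ rectangle m n ∧ ¬ c z)) := by
  rintro ⟨⟨x, hx, y, hy, P, hP⟩, ⟨t, ht, s, hs, Q, hQ⟩⟩
  have hx' := Finset.mem_filter.1 hx; have hy' := Finset.mem_filter.1 hy
  have ht' := Finset.mem_filter.1 ht; have hs' := Finset.mem_filter.1 hs
  obtain ⟨z, hzP, hzQ⟩ := exists_mem_support_of_crossing_star (L := 0) (R := m) (B := 0) (T := n) P Q.reverse
    (fun z hz => by have := mem_rectangle_iff.1 (hP z hz).1; exact ⟨this.1, this.2.1, this.2.2.1, this.2.2.2⟩)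
    (fun z hz => by
      rw [Walk.support_reverse, List.mem_reverse] at hz
      have := mem_rectangle_iff.1 (hQ z hz).1; exact ⟨this.1, this.2.1, this.2.2.1, this.2.2.2⟩)
    hx'.2 hy'.2 hs'.2 ht'.2
  rw [Walk.support_reverse, List.mem_reverse] at hzQ
  exact (hQ z hzQ).2 (hP z hzP).2

/-- **Matching-pair duality for site crossings of a rectangle** (Kesten 1982, Prop. 2.2): exactly
one of the `+` left-right crossing and the `-∗` top-bottom crossing occurs (`m ≥ 1`). [cite: Kesten1982, Prop. 2.2] -/
theorem plusLRCrossing_xor_minusStarTBCrossing (c : Site 2 → Prop) (hm : 1 ≤ m) (n : ℕ) :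
    Xor (∃ x ∈ leftSide m n, ∃ y ∈ rightSide m n, ∃ p : (zdGraph 2).Walk x y, ∀ z ∈ p.support, z ∈ rectangle m n ∧ c z)
      (∃ x ∈ topSide m n, ∃ y ∈ bottomSide m n, ∃ q : zdStarGraph.Walk x y, ∀ z ∈ q.support, z ∈ rectangle m n ∧ ¬ c z) := by
  have h1 := plusLRCrossing_or_minusStarTBCrossing c hm n
  have h2 := not_plusLRCrossing_and_minusStarTBCrossing c m n
  rcases h1 with h | h
  · exact Or.inl ⟨h, fun h' => h2 ⟨h, h'⟩⟩
  · exact Or.inr ⟨h, fun h' => h2 ⟨h', h⟩⟩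

end Literature.Probability.Percolation
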